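import Summits.CriticalPhenomena.PercolationContinuityZ3.Theorems.PercNearOneGluingNoHeavyLowerTailHybridThreePointLBClusters
import Summits.CriticalPhenomena.PercolationContinuityZ3.Theorems.PercNearOneGluingNoHeavyLowerTailThreePointLBSwitchingMaps
import HarnessLib

/-!
# `NoHeavyLowerTail` (stmt-CriticalPhenomena-4575) — HYBRID / GROUP three-point lower bound by four switchings, II:
# the four group switchings `Φ₁ … Φ₄` preserve `μ ⊗ μ ⊗ μ`

Support file (prover prim-cert-2 gen 9; `--supports stmt-CriticalPhenomena-4575`).  No named facts, no sorries.

The four three-copy switchings of prim-ineq-gen-8's THEOREM-HYBRID-3PTLB (lit-2's PROOF-3PTLB Variant C with GROUP explorations), on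
triples `x = (X, Y, Z) = (x 0, x 1, x 2)` of configurations, with `A′ = gcl X P₃′` (the union of the `X`-clusters of the large
a-pole), `B = gcl X P₁`, `C = gcl X {c} (= cl X c)` and `splice F K₁ K₂` = (`K₁` on `F`, `K₂` off `F`):
* `Φ₁(X,Y,Z) = (Y_{touch A′} X, X_{touch A′} Y, Z)` — explore the group `P₃′` in `X`, exchange `X ↔ Y` on the pairs meeting it;
* `Φ₂(X,Y,Z) = (Z_{touch B} X, Y, X_{touch B} Z)` — explore `P₁`, exchange `X ↔ Z`;
* `Φ₃(X,Y,Z) = (Y_{touch A′} Z_{touch B ∖ touch A′} X, X_{touch A′} Y, X_{touch B ∖ touch A′} Z)` — `P₃′ → Y`, then `P₁ → Z`;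
* `Φ₄(X,Y,Z) = (Z_{touch C} Y_{touch A′ ∖ touch C} X, X_{touch A′ ∖ touch C} Y, X_{touch C} Z)` — `c → Z`, then `P₃′ → Y`.
All are instances of the tree's two-region switching `DecisionTree.splice3` [GladkovZimin2024, Lemma 4.2, three-copy form;
`DecisionTree.sum_wt3W_comp_splice3`], `Φ₄` conjugated by the exchange of copies `1, 2`; the regions are self-determined
(`selfDetermined_touch_gcl`, file I).  Hence `sum_wt3W_gphi1 … sum_wt3W_gphi4`: each preserves the triple law ("a group exploration is a
sequence of cluster explorations", THEOREM-HYBRID-3PTLB Lemma 1).  Output formulas `gphi*_zero/one/two`.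
-/

noncomputable section

namespace Summit.CriticalPhenomena.PercolationContinuityZ3.Theorems

namespace HybridThreePointLB

open Finset Literature.Probability.Percolation Literature.Probability.Percolation.DecisionTree
open Literature.Probability.Percolation.Gladkov ThreePointLB
open scoped Classical

variable {V : Type*} [Fintype V] [DecidableEq V]

/-! ### The four group switchings -/

/-- `Φ₁`: explore the group `S′` in copy `0` and exchange copies `0, 1` on the pairs meeting `gcl (x 0) S′`.
[cite: GladkovZimin2024, Example 4.4 (three-copy form, union of clusters)] -/
def gphi1 (S' : Finset V) : (Fin 3 → Finset (Sym2 V)) → (Fin 3 → Finset (Sym2 V)) :=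
  splice3 (fun K => touch (gcl K S')) (fun _ => ∅)

/-- `Φ₂`: explore the group `S₁` in copy `0` and exchange copies `0, 2` there.
[cite: GladkovZimin2024, Example 4.4 (three-copy form, union of clusters)] -/
def gphi2 (S₁ : Finset V) : (Fin 3 → Finset (Sym2 V)) → (Fin 3 → Finset (Sym2 V)) :=
  splice3 (fun _ => ∅) (fun K => touch (gcl K S₁))

/-- `Φ₃`: `Φ₁`'s exploration of `S′` (to copy `1`), then explore `S₁` on the unused pairs (to copy `2`).
[cite: GladkovZimin2024, proof of Thm. 4.6 (successive explorations; three-copy form)] -/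
def gphi3 (S' S₁ : Finset V) : (Fin 3 → Finset (Sym2 V)) → (Fin 3 → Finset (Sym2 V)) :=
  splice3 (fun K => touch (gcl K S')) (fun K => touch (gcl K S₁) \ touch (gcl K S'))

/-- `Φ₄`: explore the vertex `c` (to copy `2`), then the group `S′` on the unused pairs (to copy `1`) — the two-region switching with
the roles of copies `1, 2` exchanged. [cite: GladkovZimin2024, proof of Thm. 4.6 (successive explorations; three-copy form)] -/
def gphi4 (c : V) (S' : Finset V) (x : Fin 3 → Finset (Sym2 V)) : Fin 3 → Finset (Sym2 V) := fun k =>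
  splice3 (fun K => touch (gcl K {c})) (fun K => touch (gcl K S') \ touch (gcl K {c}))
    (fun i => x (Equiv.swap 1 2 i)) (Equiv.swap 1 2 k)

section Outputs

variable (c : V) (S' S₁ : Finset V) (x : Fin 3 → Finset (Sym2 V))

/-- Output `0` of `Φ₁`. [this work] -/
@[simp] theorem gphi1_zero : gphi1 S' x 0 = splice (touch (gcl (x 0) S')) (x 1) (x 0) := by
  rw [gphi1, splice3_zero, splice_empty]
/-- Output `1` of `Φ₁`. [this work] -/
@[simp] theorem gphi1_one : gphi1 S' x 1 = splice (touch (gcl (x 0) S')) (x 0) (x 1) := by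
  rw [gphi1, splice3_one]
/-- Output `2` of `Φ₁`. [this work] -/
@[simp] theorem gphi1_two : gphi1 S' x 2 = x 2 := by
  rw [gphi1, splice3_two, splice_empty]
/-- Output `0` of `Φ₂`. [this work] -/
@[simp] theorem gphi2_zero : gphi2 S₁ x 0 = splice (touch (gcl (x 0) S₁)) (x 2) (x 0) := by
  rw [gphi2, splice3_zero, splice_empty]
/-- Output `1` of `Φ₂`. [this work] -/
@[simp] theorem gphi2_one : gphi2 S₁ x 1 = x 1 := by
  rw [gphi2, splice3_one, splice_empty]
/-- Output `2` of `Φ₂`. [this work] -/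
@[simp] theorem gphi2_two : gphi2 S₁ x 2 = splice (touch (gcl (x 0) S₁)) (x 0) (x 2) := by
  rw [gphi2, splice3_two]
/-- Output `0` of `Φ₃`. [this work] -/
@[simp] theorem gphi3_zero : gphi3 S' S₁ x 0 =
    splice (touch (gcl (x 0) S')) (x 1) (splice (touch (gcl (x 0) S₁) \ touch (gcl (x 0) S')) (x 2) (x 0)) := by
  rw [gphi3, splice3_zero]
/-- Output `1` of `Φ₃`. [this work] -/
@[simp] theorem gphi3_one : gphi3 S' S₁ x 1 = splice (touch (gcl (x 0) S')) (x 0) (x 1) := by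
  rw [gphi3, splice3_one]
/-- Output `2` of `Φ₃`. [this work] -/
@[simp] theorem gphi3_two : gphi3 S' S₁ x 2 = splice (touch (gcl (x 0) S₁) \ touch (gcl (x 0) S')) (x 0) (x 2) := by
  rw [gphi3, splice3_two]

/-- `(1 2)` fixes `0` in `Fin 3`. [folklore] -/
private theorem swap12_0 : (Equiv.swap (1 : Fin 3) 2) 0 = 0 := by decide
/-- `(1 2)` sends `1 ↦ 2` in `Fin 3`. [folklore] -/
private theorem swap12_1 : (Equiv.swap (1 : Fin 3) 2) 1 = 2 := by decide
/-- `(1 2)` sends `2 ↦ 1` in `Fin 3`. [folklore] -/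
private theorem swap12_2 : (Equiv.swap (1 : Fin 3) 2) 2 = 1 := by decide

/-- Output `0` of `Φ₄`. [this work] -/
@[simp] theorem gphi4_zero : gphi4 c S' x 0 =
    splice (touch (gcl (x 0) {c})) (x 2) (splice (touch (gcl (x 0) S') \ touch (gcl (x 0) {c})) (x 1) (x 0)) := by
  simp only [gphi4, swap12_0, splice3_zero, swap12_1, swap12_2]
/-- Output `1` of `Φ₄`. [this work] -/
@[simp] theorem gphi4_one : gphi4 c S' x 1 = splice (touch (gcl (x 0) S') \ touch (gcl (x 0) {c})) (x 0) (x 1) := by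
  simp only [gphi4, swap12_1, splice3_two, swap12_0, swap12_2]
/-- Output `2` of `Φ₄`. [this work] -/
@[simp] theorem gphi4_two : gphi4 c S' x 2 = splice (touch (gcl (x 0) {c})) (x 0) (x 2) := by
  simp only [gphi4, swap12_2, splice3_one, swap12_0, swap12_1]

end Outputs

/-! ### Each group switching preserves the triple law -/

section Law

variable (p : Sym2 V → ℝ) (D : Finset (Sym2 V)) (c : V) (S' S₁ : Finset V) (f : (Fin 3 → Finset (Sym2 V)) → ℝ)

/-- **`Φ₁` preserves `μ ⊗ μ ⊗ μ`.** [cite: GladkovZimin2024, Lemma 4.2 and Example 4.4] -/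
theorem sum_wt3W_gphi1 :
    ∑ x ∈ triples D, wt3W D p x * f (gphi1 S' x) = ∑ x ∈ triples D, wt3W D p x * f x := by
  unfold gphi1
  exact sum_wt3W_comp_splice3 p (selfDetermined_touch_gcl S') (fun K => Finset.disjoint_empty_left _)
    (fun _ _ _ => rfl) D f

/-- **`Φ₂` preserves `μ ⊗ μ ⊗ μ`.** [cite: GladkovZimin2024, Lemma 4.2 and Example 4.4] -/
theorem sum_wt3W_gphi2 :
    ∑ x ∈ triples D, wt3W D p x * f (gphi2 S₁ x) = ∑ x ∈ triples D, wt3W D p x * f x := by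
  unfold gphi2
  refine sum_wt3W_comp_splice3 p (fun _ _ _ => rfl) (fun K => Finset.disjoint_empty_right _)
    (fun K K' h => ?_) D f
  rw [gcl_eq_of_agree fun e he => h e (Finset.mem_union_right _ he)]

/-- **`Φ₃` preserves `μ ⊗ μ ⊗ μ`.** [cite: GladkovZimin2024, Lemma 4.2 and proof of Thm. 4.6] -/
theorem sum_wt3W_gphi3 :
    ∑ x ∈ triples D, wt3W D p x * f (gphi3 S' S₁ x) = ∑ x ∈ triples D, wt3W D p x * f x := by
  unfold gphi3
  exact sum_wt3W_comp_splice3 p (selfDetermined_touch_gcl S') (fun K => Finset.sdiff_disjoint)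
    (touch_gsdiff_congr S' S₁) D f

/-- **`Φ₄` preserves `μ ⊗ μ ⊗ μ`** (two-region switching conjugated by the exchange of copies `1, 2`).
[cite: GladkovZimin2024, Lemma 4.2 and proof of Thm. 4.6] -/
theorem sum_wt3W_gphi4 :
    ∑ x ∈ triples D, wt3W D p x * f (gphi4 c S' x) = ∑ x ∈ triples D, wt3W D p x * f x := by
  set σ : Equiv.Perm (Fin 3) := Equiv.swap 1 2 with hσ
  set R : Finset (Sym2 V) → Finset (Sym2 V) := fun K => touch (gcl K {c}) with hR
  set S : Finset (Sym2 V) → Finset (Sym2 V) := fun K => touch (gcl K S') \ touch (gcl K {c}) with hS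
  have hphi : ∀ x, gphi4 c S' x = fun k => splice3 R S (fun i => x (σ i)) (σ k) := fun x => rfl
  calc ∑ x ∈ triples D, wt3W D p x * f (gphi4 c S' x)
      = ∑ x ∈ triples D, (fun y => wt3W D p y * f (fun k => splice3 R S y (σ k))) (fun i => x (σ i)) := by
        refine Finset.sum_congr rfl fun x _ => ?_
        simp only [hphi, DTree3.wt3W_comp_perm]
    _ = ∑ y ∈ triples D, wt3W D p y * f (fun k => splice3 R S y (σ k)) :=
        DTree3.sum_triples_comp_perm D σ (fun y => wt3W D p y * f (fun k => splice3 R S y (σ k)))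
    _ = ∑ y ∈ triples D, wt3W D p y * f (fun k => y (σ k)) :=
        sum_wt3W_comp_splice3 p (selfDetermined_touch_gcl {c}) (fun K => Finset.sdiff_disjoint)
          (touch_gsdiff_congr {c} S') D (fun y => f (fun k => y (σ k)))
    _ = ∑ y ∈ triples D, wt3W D p y * f y := by
        have h := DTree3.sum_triples_comp_perm D σ (fun y => wt3W D p y * f y)
        simpa only [DTree3.wt3W_comp_perm] using h

end Law

end HybridThreePointLB

end Summit.CriticalPhenomena.PercolationContinuityZ3.Theorems

end
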